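import Literature.Geometry.Symplectic.SteinBoundaryContact
import HarnessLib

/-!
# The contact planes of a Stein domain are `2`-planes; the twisting loop of a framing of a
# Legendrian knot does not vanish (proofs file)

Sibling proofs file of `Literature/Geometry/Symplectic/SteinBoundaryContact.lean` (fact seat
`provefact-Literature.Symplectic.akbulut_matveyev`; follow-up asked for in the review of p12887, item 2:
*"twistingLoop is nowhere zero for an IsKnotFraming of a Legendrian knot ... but this is not
recorded, so twisting is only documented, not proved, to be non-junk"*).  Everything here is
**proved**; no statement of the definitions file is changed.

* `SteinStructure.finrank_contactPlane` — **the complex tangencies `ξ_x = T_x∂W ∩ J_x⁻¹ T_x∂W`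
  form a `2`-plane at every point** (AM §1: *"a distribution of maximal complex subspaces in `TX`
  tangent to `∂X`"*): the two linear forms `v ↦ v 0`, `v ↦ (J v) 0` cutting out `ξ_x` are
  linearly independent, because for `w` with `w 0 = 1` and `a = (J w) 0` they take the values
  `(1, a)` on `w` and `(a, -1)` on `J w` (`J² = -1`), and `-1 - a² ≠ 0`; rank–nullity.
* `IsLegendrianKnot.contactPlane_eq_span` — along a Legendrian knot, `ξ = ℝ ċ ⊕ ℝ J ċ` (the tree's
  `knotVelocity_ne_zero` and `canonicalFraming_not_mem_span` give two independent vectors of the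
  `2`-plane).
* `IsKnotFraming.twistingLoop_ne_zero` — **the twisting loop `t ↦ (ω(ċ, ν), α(ν))` of a framing
  `ν` of a Legendrian knot never vanishes**: `α(ν) = 0` forces `ν ∈ T∂W ∩ ker α = ξ`
  (`mem_contactPlane_of_contactForm_eq_zero`), so `ν = s ċ + r J ċ` and
  `ω(ċ, ν) = r ω(ċ, J ċ)` with `ω(ċ, J ċ) > 0` (`J`-convexity), so `ω(ċ, ν) = 0` forces `r = 0`
  and `ν ∈ ℝ ċ`, excluded by `IsKnotFraming.not_mem_span`.  Hence `SteinStructure.twisting` is the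
  winding number of a loop in `ℂ ∖ {0}`, as the rotation number of `ν` against the frame
  `(J ċ, R)` should be (Gompf 1998, §1: the canonical framing "is induced by any vector field
  transverse to `ξ`, or equivalently, by a vector field in `ξ|L` transverse to `L`").
* On the way: the Kähler form `ω = -dd^ℂφ` is alternating and bilinear in the form used by the
  definitions file (`SteinStructure.kahlerForm_self/_swap/_add_left/_smul_left/_add_right/
  _smul_right`, from Mathlib's `ContinuousAlternatingMap` API on `![u, v]`).

* `SteinStructure.exists_isBoundaryPoint`, `not_isSteinDomain_of_forall_isInteriorPoint` — **a
  Stein structure on a nonempty compact `W` has a boundary point** (`φ` attains its maximum and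
  `SteinStructure.boundary_eq`): the crudest maximum principle, ruling out the degenerate reading
  `X = X ∪ ∅` of a convex decomposition (`AkbulutMatveyev.lean`).

Continuity of the twisting loop of a general framing (bundle-level continuity of `J`, `dφ` and
`dd^ℂφ` along the knot) is still not addressed here.

## References

* R. E. Gompf, *Handlebody construction of Stein surfaces*, Ann. of Math. 148 (1998), 619–693
  (arXiv:math/9803019), §1. [Gompf1998]
* S. Akbulut, R. Matveyev, *A convex decomposition theorem for 4-manifolds*, IMRN 1998, no. 7,
  371–381 (arXiv:math/0010166), §1. [AkbulutMatveyev1998]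
-/

noncomputable section

open scoped Manifold ContDiff Topology
open Set Function Module

namespace Literature.Geometry.Symplectic

/-! ### Alternating `2`-forms on `EuclideanSpace ℝ (Fin 4)` evaluated on `![u, v]` -/

/-- An alternating `2`-form is skew: `M(u, v) = -M(v, u)`. [folklore] -/
theorem alt2_swap (M : EuclideanSpace ℝ (Fin 4) [⋀^Fin 2]→L[ℝ] ℝ) (u v : EuclideanSpace ℝ (Fin 4)) :
    M ![u, v] = -M ![v, u] := by
  have h := M.map_swap ![v, u] (i := 0) (j := 1) (by decide)
  have e : ((![v, u] : Fin 2 → EuclideanSpace ℝ (Fin 4)) ∘ (Equiv.swap (0 : Fin 2) 1)) =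
      ![u, v] := by
    ext i : 1
    fin_cases i <;> rfl
  rw [e] at h
  exact h

/-- An alternating `2`-form vanishes on the diagonal. [folklore] -/
theorem alt2_self (M : EuclideanSpace ℝ (Fin 4) [⋀^Fin 2]→L[ℝ] ℝ) (v : EuclideanSpace ℝ (Fin 4)) :
    M ![v, v] = 0 :=
  M.map_eq_zero_of_eq ![v, v] (i := 0) (j := 1) rfl (by decide)

variable {W : Type*} [TopologicalSpace W] [ChartedSpace (EuclideanHalfSpace 4) W]
  [IsManifold (𝓡∂ 4) ∞ W] [CompactSpace W]

namespace SteinStructure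

/-- The Kähler form is alternating: `ω(v, v) = 0`. [folklore] -/
theorem kahlerForm_self (S : SteinStructure W) (x : W) (v : EuclideanSpace ℝ (Fin 4)) :
    S.kahlerForm x v v = 0 := by
  have h := alt2_self (Kaehler.mextDeriv (dComplex S.J S.φ) x) v
  unfold kahlerForm
  rw [neg_eq_zero]
  exact h

/-- The Kähler form is skew-symmetric. [folklore] -/
theorem kahlerForm_swap (S : SteinStructure W) (x : W) (u v : EuclideanSpace ℝ (Fin 4)) :
    S.kahlerForm x u v = -S.kahlerForm x v u := by
  have h := alt2_swap (Kaehler.mextDeriv (dComplex S.J S.φ) x) u v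
  unfold kahlerForm
  exact congrArg Neg.neg h

/-- The Kähler form is additive in its first argument. [folklore] -/
theorem kahlerForm_add_left (S : SteinStructure W) (x : W) (u u' v : EuclideanSpace ℝ (Fin 4)) :
    S.kahlerForm x (u + u') v = S.kahlerForm x u v + S.kahlerForm x u' v := by
  have h := (Kaehler.mextDeriv (dComplex S.J S.φ) x).vecCons_add ![v] u u'
  unfold kahlerForm
  rw [← neg_add]
  exact congrArg Neg.neg h

/-- The Kähler form is homogeneous in its first argument. [folklore] -/
theorem kahlerForm_smul_left (S : SteinStructure W) (x : W) (c : ℝ)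
    (u v : EuclideanSpace ℝ (Fin 4)) :
    S.kahlerForm x (c • u) v = c * S.kahlerForm x u v := by
  have h := (Kaehler.mextDeriv (dComplex S.J S.φ) x).vecCons_smul ![v] c u
  unfold kahlerForm
  rw [mul_neg, ← smul_eq_mul]
  exact congrArg Neg.neg h

/-- The Kähler form is additive in its second argument. [folklore] -/
theorem kahlerForm_add_right (S : SteinStructure W) (x : W) (u v v' : EuclideanSpace ℝ (Fin 4)) :
    S.kahlerForm x u (v + v') = S.kahlerForm x u v + S.kahlerForm x u v' := by
  rw [S.kahlerForm_swap x u, S.kahlerForm_add_left, neg_add, ← S.kahlerForm_swap,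
    ← S.kahlerForm_swap]

/-- The Kähler form is homogeneous in its second argument. [folklore] -/
theorem kahlerForm_smul_right (S : SteinStructure W) (x : W) (c : ℝ)
    (u v : EuclideanSpace ℝ (Fin 4)) :
    S.kahlerForm x u (c • v) = c * S.kahlerForm x u v := by
  rw [S.kahlerForm_swap x u, S.kahlerForm_smul_left, ← mul_neg, ← S.kahlerForm_swap]

/-- **The complex tangencies form a `2`-plane**: `dim ξ_x = 2` at every point (the linear forms
`v ↦ v 0` and `v ↦ (J v) 0` cutting out `ξ_x = T_x∂W ∩ J_x⁻¹ T_x∂W` are linearly independent: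
for `w` with `w 0 = 1` and `a = (J w) 0` they take the values `(1, a)` on `w` and `(a, -1)` on
`J w`). AM §1: *"a distribution of maximal complex subspaces in `TX` tangent to `∂X`"*.
[cite: AkbulutMatveyev1998, §1] -/
theorem finrank_contactPlane (S : SteinStructure W) (x : W) :
    finrank ℝ (contactPlane S.J x) = 2 := by
  -- the linear map `Φ v = (v 0, (J v) 0)` with kernel `ξ_x`
  let p : EuclideanSpace ℝ (Fin 4) →ₗ[ℝ] ℝ :=
    (EuclideanSpace.proj (0 : Fin 4) : EuclideanSpace ℝ (Fin 4) →L[ℝ] ℝ).toLinearMap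
  let Φ : EuclideanSpace ℝ (Fin 4) →ₗ[ℝ] ℝ × ℝ := p.prod (p.comp (S.J x).toLinearMap)
  have hker : LinearMap.ker Φ = contactPlane S.J x := by
    ext v
    rw [LinearMap.mem_ker, mem_contactPlane_iff]
    change ((v 0, S.J x v 0) : ℝ × ℝ) = 0 ↔ _
    rw [Prod.mk_eq_zero]
  -- `Φ` is onto
  have hsurj : Function.Surjective Φ := by
    let w : EuclideanSpace ℝ (Fin 4) := EuclideanSpace.single (0 : Fin 4) (1 : ℝ)
    have hw : w 0 = 1 := by simp [w]
    set a : ℝ := S.J x w 0 with ha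
    have hJw : S.J x (S.J x w) 0 = -1 := by rw [S.J_sq, PiLp.neg_apply, hw]
    have h1 : (1 : ℝ) + a * a ≠ 0 := (add_pos_of_pos_of_nonneg one_pos (mul_self_nonneg a)).ne'
    rintro ⟨r, q⟩
    refine ⟨((r + q * a) / (1 + a * a)) • w + ((r * a - q) / (1 + a * a)) • S.J x w, ?_⟩
    change ((((r + q * a) / (1 + a * a)) • w + ((r * a - q) / (1 + a * a)) • S.J x w) 0,
      S.J x (((r + q * a) / (1 + a * a)) • w + ((r * a - q) / (1 + a * a)) • S.J x w) 0) = (r, q)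
    rw [map_add, map_smul, map_smul]
    simp only [PiLp.add_apply, PiLp.smul_apply, smul_eq_mul, hw, hJw, Prod.mk.injEq]
    rw [← ha]
    constructor
    · field_simp
      ring
    · field_simp
      ring
  have hrange : finrank ℝ (LinearMap.range Φ) = 2 := by
    rw [LinearMap.range_eq_top.2 hsurj, finrank_top, finrank_prod, finrank_self]
  have h := Φ.finrank_range_add_finrank_ker
  rw [hrange, finrank_euclideanSpace_fin, hker] at h
  omega

end SteinStructure

/-- **Along a Legendrian knot the contact plane is spanned by `ċ` and `J ċ`** (`ċ ≠ 0` and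
`J ċ ∉ ℝ ċ` lie in the `2`-plane `ξ`). [cite: Gompf1998, §1] -/
theorem IsLegendrianKnot.contactPlane_eq_span {S : SteinStructure W}
    {K : Metric.sphere (0 : EuclideanSpace ℝ (Fin 2)) 1 → W}
    (hK : IsLegendrianKnot S.J K) (t : ℝ) :
    contactPlane S.J (K (Literature.Topology.FourManifolds.circlePt t)) =
      Submodule.span ℝ {knotVelocity K t, S.J (K (Literature.Topology.FourManifolds.circlePt t)) (knotVelocity K t)} := by
  set x := K (Literature.Topology.FourManifolds.circlePt t)
  set c : EuclideanSpace ℝ (Fin 4) := knotVelocity K t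
  have hd : MDifferentiable (𝓡 1) (𝓡∂ 4) K := fun u =>
    hK.isSmoothEmbedding.contMDiff.mdifferentiableAt (by simp)
  have hc : c ∈ contactPlane S.J x := hK.knotVelocity_mem t
  have hJc : S.J x c ∈ contactPlane S.J x := hK.J_knotVelocity_mem t
  have hc0 : c ≠ 0 := knotVelocity_ne_zero hK.isSmoothEmbedding t
  have hnot : S.J x c ∉ (ℝ ∙ c : Submodule ℝ (EuclideanSpace ℝ (Fin 4))) := by
    have h := canonicalFraming_not_mem_span hK.isSmoothEmbedding S.J_sq t
    rwa [canonicalFraming_circlePt S.J hd t] at h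
  have hli : LinearIndependent ℝ ![c, S.J x c] := by
    refine LinearIndependent.pair_iff.2 fun s r hsr => ?_
    by_cases hr : r = 0
    · subst hr
      rw [zero_smul, add_zero, smul_eq_zero] at hsr
      exact ⟨hsr.resolve_right hc0, rfl⟩
    · exfalso
      apply hnot
      rw [Submodule.mem_span_singleton]
      refine ⟨-(s / r), ?_⟩
      have h1 : r • S.J x c = -(s • c) := eq_neg_of_add_eq_zero_right hsr
      have h2 : S.J x c = r⁻¹ • (-(s • c)) := by
        rw [← h1, smul_smul, inv_mul_cancel₀ hr, one_smul]
      rw [h2, smul_neg, smul_smul, neg_smul, div_eq_inv_mul]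
  have hle : Submodule.span ℝ {c, S.J x c} ≤ contactPlane S.J x := by
    rw [Submodule.span_le]
    rintro v (rfl | rfl)
    · exact hc
    · exact hJc
  symm
  refine Submodule.eq_of_le_of_finrank_eq hle ?_
  rw [S.finrank_contactPlane]
  have h2 := finrank_span_eq_card hli
  rwa [Matrix.range_cons_cons_empty, Fintype.card_fin] at h2

/-- **The twisting loop of a framing of a Legendrian knot never vanishes** (so that the
twisting number `SteinStructure.twisting` is the winding number of a loop in `ℂ ∖ {0}`, as a
rotation number should be): if `α(ν) = 0` then `ν ∈ T∂W ∩ ker α = ξ = ℝ ċ ⊕ ℝ J ċ`, and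
`ω(ċ, ν) = 0` kills the `J ċ`-component (`ω(ċ, ċ) = 0 < ω(ċ, J ċ)`), leaving `ν ∈ ℝ ċ`, which
is excluded for a framing. [cite: Gompf1998, §1] -/
theorem IsKnotFraming.twistingLoop_ne_zero {S : SteinStructure W}
    {K : Metric.sphere (0 : EuclideanSpace ℝ (Fin 2)) 1 → W}
    {ν : Metric.sphere (0 : EuclideanSpace ℝ (Fin 2)) 1 → EuclideanSpace ℝ (Fin 4)}
    (hν : IsKnotFraming K ν) (hK : IsLegendrianKnot S.J K) (t : ℝ) :
    S.twistingLoop K ν t ≠ 0 := by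
  intro h0
  have hω : S.kahlerForm (K (Literature.Topology.FourManifolds.circlePt t)) (knotVelocity K t) (ν (Literature.Topology.FourManifolds.circlePt t)) = 0 := by
    have := congrArg Complex.re h0
    simpa [SteinStructure.twistingLoop] using this
  have hα : S.contactForm (K (Literature.Topology.FourManifolds.circlePt t)) (ν (Literature.Topology.FourManifolds.circlePt t)) = 0 := by
    have := congrArg Complex.im h0
    simpa [SteinStructure.twistingLoop] using this
  have hx : (𝓡∂ 4).IsBoundaryPoint (K (Literature.Topology.FourManifolds.circlePt t)) := hK.isBoundaryPoint _
  have hn : ν (Literature.Topology.FourManifolds.circlePt t) ∈ contactPlane S.J (K (Literature.Topology.FourManifolds.circlePt t)) :=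
    S.mem_contactPlane_of_contactForm_eq_zero hx (hν.mem_boundaryTangentSpace _) hα
  rw [hK.contactPlane_eq_span t, Submodule.mem_span_pair] at hn
  obtain ⟨s, r, hsr⟩ := hn
  have hpos : 0 < S.kahlerForm (K (Literature.Topology.FourManifolds.circlePt t)) (knotVelocity K t)
      (S.J (K (Literature.Topology.FourManifolds.circlePt t)) (knotVelocity K t)) :=
    S.kahlerForm_self_J_pos _ (knotVelocity_ne_zero hK.isSmoothEmbedding t)
  have hωc : S.kahlerForm (K (Literature.Topology.FourManifolds.circlePt t)) (knotVelocity K t) (ν (Literature.Topology.FourManifolds.circlePt t)) =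
      r * S.kahlerForm (K (Literature.Topology.FourManifolds.circlePt t)) (knotVelocity K t)
        (S.J (K (Literature.Topology.FourManifolds.circlePt t)) (knotVelocity K t)) := by
    rw [← hsr, S.kahlerForm_add_right, S.kahlerForm_smul_right, S.kahlerForm_smul_right,
      S.kahlerForm_self, mul_zero, zero_add]
  have hr : r = 0 := by
    rw [hω] at hωc
    exact (mul_eq_zero.1 hωc.symm).resolve_right hpos.ne'
  rw [hr, zero_smul, add_zero] at hsr
  exact hν.not_mem_span t (Submodule.mem_span_singleton.2 ⟨s, hsr⟩)

/-- In particular the twisting loop of a framing of a Legendrian knot takes values in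
`ℂ ∖ {0}`. [cite: Gompf1998, §1] -/
theorem IsKnotFraming.range_twistingLoop_subset {S : SteinStructure W}
    {K : Metric.sphere (0 : EuclideanSpace ℝ (Fin 2)) 1 → W}
    {ν : Metric.sphere (0 : EuclideanSpace ℝ (Fin 2)) 1 → EuclideanSpace ℝ (Fin 4)}
    (hν : IsKnotFraming K ν) (hK : IsLegendrianKnot S.J K) :
    range (S.twistingLoop K ν) ⊆ {0}ᶜ := by
  rintro _ ⟨t, rfl⟩
  exact hν.twistingLoop_ne_zero hK t

/-! ### A nonempty Stein domain has boundary points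

The crudest form of the maximum principle built into `SteinStructure`: `φ` attains its maximum
on the compact manifold `W`, and `SteinStructure.boundary_eq` says that the maximum points are
exactly the boundary points.  Hence a nonempty compact `C^∞` 4-manifold all of whose points are
interior points (e.g. a closed 4-manifold re-charted on the half-space) is never a Stein domain,
which rules out reading `X = X ∪ ∅` as a convex decomposition in
`Literature.Geometry.Symplectic.akbulut_matveyev`. -/

namespace SteinStructure

/-- The `J`-convex function of a Stein structure on a nonempty (compact) `W` attains its
supremum. [folklore] -/
theorem exists_φ_eq_sSup [Nonempty W] (S : SteinStructure W) : ∃ x : W, S.φ x = sSup (range S.φ) :=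
  (isCompact_range S.φ_smooth.continuous).sSup_mem (range_nonempty _)

/-- **A Stein structure on a nonempty compact 4-manifold has a boundary point** (a maximum
point of `φ`, `SteinStructure.boundary_eq`). [folklore] -/
theorem exists_isBoundaryPoint [Nonempty W] (S : SteinStructure W) :
    ∃ x : W, (𝓡∂ 4).IsBoundaryPoint x := by
  obtain ⟨x, hx⟩ := S.exists_φ_eq_sSup
  exact ⟨x, (S.boundary_eq x).2 hx⟩

/-- There is no Stein structure on a nonempty compact 4-manifold all of whose points are
interior points. [folklore] -/
theorem isEmpty_of_forall_isInteriorPoint [Nonempty W]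
    (h : ∀ x : W, (𝓡∂ 4).IsInteriorPoint x) : IsEmpty (SteinStructure W) :=
  ⟨fun S => by
    obtain ⟨x, hx⟩ := S.exists_isBoundaryPoint
    exact ((𝓡∂ 4).isInteriorPoint_iff_not_isBoundaryPoint x).1 (h x) hx⟩

end SteinStructure

/-- A nonempty compact 4-manifold without boundary points is not a Stein domain
(`IsSteinDomain`). [folklore] -/
theorem not_isSteinDomain_of_forall_isInteriorPoint [Nonempty W]
    (h : ∀ x : W, (𝓡∂ 4).IsInteriorPoint x) : ¬ IsSteinDomain W :=
  fun hS => (SteinStructure.isEmpty_of_forall_isInteriorPoint h).false hS.some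

/-- Equivalently: a Stein domain is empty or has a boundary point. [folklore] -/
theorem IsSteinDomain.isEmpty_or_exists_isBoundaryPoint (hS : IsSteinDomain W) :
    IsEmpty W ∨ ∃ x : W, (𝓡∂ 4).IsBoundaryPoint x := by
  rcases isEmpty_or_nonempty W with hW | hW
  · exact Or.inl hW
  · exact Or.inr hS.some.exists_isBoundaryPoint

end Literature.Geometry.Symplectic

end
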